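import Literature.MathematicalPhysics.QuantumLattice.ReflectionSymmetricIceRule
import Literature.MathematicalPhysics.QuantumLattice.AnisotropicHeisenbergGaussianDomination
import Literature.MathematicalPhysics.QuantumLattice.HeisenbergModelGlobalRotationProofs
import HarnessLib

/-!
# Lieb–Schupp: singlet ground states, the ice rule and the field inequality for
# reflection-symmetric (frustrated) Heisenberg models with antiferromagnetic crossing bonds

Topic `MathematicalPhysics/QuantumLattice`; the lattice-model layer over the abstract file
`ReflectionSymmetricIceRule.lean`. Sources:

* E. H. Lieb, P. Schupp, *Ground state properties of a fully frustrated quantum spin system*,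
  Phys. Rev. Lett. **83** (1999) 5362–5365 [LiebSchupp1999] (arXiv:math-ph/9908019, held);
* E. H. Lieb, P. Schupp, *Singlets and reflection symmetric spin systems*, Physica A **279**
  (2000) 378–385 [LiebSchupp2000] (arXiv:math-ph/9910037, held), §2 (the setting), §§4–5, §7;
* J. Wojtkiewicz, *Some properties of frustrated spin systems: extensions and applications of
  Lieb–Schupp approach*, Eur. Phys. J. B **44** (2005) 501 [Wojtkiewicz2005] (arXiv:cond-mat/0410244,
  held), §2 (the `J₁–J₂` square lattice with `J₂ ≤ J₁/2` as an instance).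

## The setting ([LiebSchupp2000] §2, on the even torus)

Spins `n/2` on the torus `(ℤ/Lℤ)^d` (`L` even) with an ARBITRARY symmetric pair coupling
`J : Λ → Λ → ℝ` — `pairHeisenberg n J = ½ Σ_x Σ_y J(x,y) 𝐒_x·𝐒_y` (nearest-neighbour,
next-nearest-neighbour, frustrated or not; bipartiteness is NOT assumed). Fix a pair of planes
between sites (`θ = Torus.reflectBetweenSites j a`, left half `Λ_L = torusLeftHalf L j a`). The
Lieb–Schupp hypotheses are: reflection symmetry `J(θx, θy) = J(x, y)` ("two subsystems that are
mirror images of one another … We make no further assumptions about the nature of `H_L` and `H_R`,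
in particular we do not assume that these subsystems are antiferromagnetic") and crossing bonds
"of antiferromagnetic type in the sense that `H_C = Σ_A 𝐒_A·𝐒_{A'}` with `𝐒_A = Σ_{i∈A} jᵢ 𝐬ᵢ`",
i.e. the crossing coupling matrix `C(s, s') = J(s, θs')` (`s, s' ∈ Λ_L`) is a finite sum of
squares, `C(s, s') = Σ_k v_k(s) v_k(s')` — a positive-semidefinite crossing matrix (the datum
`v : κ → Λ → ℝ`, hypothesis `hC`). Examples: the nearest-neighbour antiferromagnet (`v` = indicator
of the boundary sites), the pyrochlore checkerboard of [LiebSchupp1999] (`v` = indicator of the two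
left sites of a bisected crossed box), the `J₁–J₂` square lattice with `|J₂| ≤ J₁/2`
([Wojtkiewicz2005] §2: `v = a·δ_{s₀} + b·δ_{s₀+e}` with `a² + b² = J₁`, `ab = J₂`).

## What is proved (all spins, all dimensions, all such `J`; no named facts)

* `exists_rightHalfRotation` — the unitary `W = ⨂_{x ∈ Λ_R} e^{iπS²_x}` ("rotation by `π` around
  the 2-axis in spin-space … takes `S¹, S³` into `-S¹, -S³` while it keeps `S²` unchanged",
  [LiebSchupp1999] p. 2): `W S^α_x Wᴴ = rhSign(x, α) S^α_x`.
* `conj_pairHeisenberg_eq_rot`, `pairHeisenbergRot_eq_submatrix` — in the rotated frame and the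
  tensor-square identification `torusSplit`, `W H_J Wᴴ = (A ⊗ 1 + 1 ⊗ A - Σ_{k,α} M_{kα} ⊗ M_{kα})`
  with `A = lsLeftHamiltonian` (real symmetric) and the real crossing operators
  `M_{kα} = Σ_s v_k(s) T^α_s`, `T = (S¹, iS², S³)` ([LiebSchupp2000] §2, display for `⟨ψ|H|ψ⟩`;
  [LiebSchupp1999] eq. (ev): "Note the overall minus sign of the crossing term").
* `pairHeisenberg_exists_singlet_groundState` — **[LiebSchupp2000] §5 / [LiebSchupp1999] p. 3:
  "there is always a ground state with total spin zero"**: some non-zero ground-state vector `ψ`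
  of `H_J` has `S^α_tot ψ = 0` for all three components.
* `pairHeisenberg_iceRule` — **[LiebSchupp2000] §7 eq. (ice) / [LiebSchupp1999] p. 4, the quantum
  ice rule**: for EVERY ground-state vector `ψ`, every `k` and every component `α`,
  `⟨ψ, Σ_s v_k(s)(S^α_s + S^α_{θs}) ψ⟩ = 0` (components `1, 3` from the abstract ice rule in the
  rotated frame; component `2` by the global quarter turn about the `3`-axis, "By symmetry (ice)
  will also be true for the first spin component and, if … invariant under spin rotations, … for
  the second").
* `pairHeisenberg_groundEnergy_sub_field_ge`, `pairHeisenberg_partitionFn_sub_field_le` —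
  **[LiebSchupp2000] §7 / [LiebSchupp1999] p. 4, `E_b ≥ E_0` and eq. (ineqz) `Z_b ≤ Z_0`** (field on
  ONE crossing unit, components `α ≠ 1`; the `2`-component follows by the quarter turn): for the ice
  operator `O = Σ_s v_k(s)(S^α_s + S^α_{θs})`, `E₀(H_J - bO) ≥ E₀(H_J) - b²/2` and, for `β ≥ 0`,
  `Re tr e^{-β(H_J - bO)} ≤ e^{βb²/2} Re tr e^{-βH_J}` for all real `b` (the printed susceptibility
  bounds `χ_box ≤ 1/4` etc. are these parabola bounds read at `b → 0`; the many-box field `{b_x}`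
  of [LiebSchupp1999] eq. (ineq) is not treated here).
* `pairHeisenberg_totalSpin_mulVec_eq_zero_of_cover`, `pairHeisenberg_totalSpinSq_mulVec_eq_zero_of_cover`
  — **[LiebSchupp1999] p. 4: "in such a system the magnetization is zero both for every single box
  separately and also for the whole system … this implies that the total spin is zero for all ground
  states of such a system"**, in the general form: if for a finite family of reflection planes the
  ice operators span `S^α_tot` (`hcover`), then `S^α_tot ψ = 0` (and, for all three `α`,
  `(S_tot)² ψ = 0`) for EVERY ground-state vector `ψ` (polarization,
  `Matrix.mulVec_eq_zero_of_forall_groundSpace`).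

The `J₁–J₂` instance (the datum `v`, the covering identity) is left to a companion file; nothing
here is specific to a lattice. The existence of a ground state with positive-semidefinite
coefficient matrix is the tree's `Matrix.exists_posSemidef_groundState` applied to
`pairHeisenbergRot_eq_submatrix` and is not restated.

## References
* [LiebSchupp1999] E. H. Lieb, P. Schupp, Phys. Rev. Lett. 83 (1999) 5362, pp. 2–4 of
  arXiv:math-ph/9908019 (eqs. (ev), (ee), (ice), (ineq), (ineqz)).
* [LiebSchupp2000] E. H. Lieb, P. Schupp, Physica A 279 (2000) 378, §2, §§4–5, §7.
* [Wojtkiewicz2005] J. Wojtkiewicz, Eur. Phys. J. B 44 (2005) 501, §2.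
* [KLS1988JSP] T. Kennedy, E. H. Lieb, B. S. Shastry, J. Stat. Phys. 53 (1988) 1019, eqs. (15)–(25)
  (tensor-square identification and the real basis `T = (S¹, iS², S³)`).
-/

noncomputable section

open Matrix Finset
open scoped ComplexOrder Kronecker
open Literature.MathematicalPhysics.QuantumLattice Literature.MathematicalPhysics.QuantumLattice.SpinOperators
  Literature.Probability.LatticeModels

namespace Literature.MathematicalPhysics.QuantumLattice

variable {d : ℕ}

/-! ### §1. The pair-coupling Heisenberg Hamiltonian and the rotated crossing bond -/

section Model

variable {Λ : Type*} [Fintype Λ] [DecidableEq Λ] (n : ℕ)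

/-- **The pair-coupling Heisenberg Hamiltonian** `H_J = ½ Σ_x Σ_y J(x,y) 𝐒_x·𝐒_y` of spins `n/2`
on a finite site set, for an arbitrary real coupling function `J` (summed over ORDERED pairs, hence
the `½`; symmetric `J` is assumed where needed; diagonal values `J(x,x)` only add the constants
`J(x,x) S(S+1)/2`). [LiebSchupp1999] eq. (1) "`H = Σ_{⟨i,j⟩} 𝐬ᵢ·𝐬ⱼ` … on a general lattice";
[LiebSchupp2000] §2. [cite: LiebSchupp2000, §2] -/
def pairHeisenberg (J : Λ → Λ → ℝ) : Op Λ (n + 1) :=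
  ∑ x, ∑ y, ((J x y / 2 : ℝ) : ℂ) • spinDot n x y

/-- **The crossing bond in the rotated frame**: `-S¹_xS¹_y + S²_xS²_y - S³_xS³_y` (symmetrised
products) — the image of `𝐒_x·𝐒_y` when exactly one endpoint is rotated by `π` about the
`2`-axis ([LiebSchupp1999] p. 2, before eq. (ev): the rotation "reverses the signs of the operators
`S¹` and `S³`, while it keeps `S²` unchanged"; the summand of the tree's `dlsHamiltonian`).
[cite: LiebSchupp1999, p. 2] -/
def lsCrossBond (x y : Λ) : Op Λ (n + 1) :=
  -spinBond n 0 x y + spinBond n 1 x y - spinBond n 2 x y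

/-- The rotated crossing bond is symmetric in the two sites. [cite: LiebSchupp1999, p. 2] -/
theorem lsCrossBond_comm (x y : Λ) : lsCrossBond n y x = lsCrossBond n x y := by
  simp only [lsCrossBond, spinBond_comm]

omit [Fintype Λ] [DecidableEq Λ] in
/-- Finite sums of Hermitian matrices are Hermitian. [folklore] -/
private theorem ls_isHermitian_sum {ι : Type*} {q : ℕ} {s : Finset ι} {f : ι → Op Λ q}
    (h : ∀ i ∈ s, (f i).IsHermitian) : (∑ i ∈ s, f i).IsHermitian := by
  rw [IsHermitian, conjTranspose_sum]
  exact sum_congr rfl fun i hi => (h i hi).eq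

/-- `H_J` is Hermitian. [cite: LiebSchupp2000, §2] -/
theorem pairHeisenberg_isHermitian (J : Λ → Λ → ℝ) : (pairHeisenberg n J).IsHermitian := by
  unfold pairHeisenberg
  refine ls_isHermitian_sum fun x _ => ls_isHermitian_sum fun y _ => ?_
  exact (spinDot_isHermitian n x y).ofReal_smul _

/-- `H_J` commutes with every component of the total spin (`SU(2)` invariance).
[LiebSchupp1999] p. 2: "as long as total spin is a good quantum number". [cite: LiebSchupp1999, p. 2] -/
theorem commute_pairHeisenberg_totalSpin (J : Λ → Λ → ℝ) (α : Fin 3) :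
    Commute (pairHeisenberg n J) (totalSpin n α) := by
  unfold pairHeisenberg
  exact Commute.sum_left _ _ _ fun x _ => Commute.sum_left _ _ _ fun y _ =>
    (commute_spinDot_totalSpin n x y α).smul_left _

end Model

/-! ### §2. Reality and symmetry of the spin matrices in the `S³`-basis -/

section Reality

variable {Λ : Type*} [Fintype Λ] [DecidableEq Λ] (n : ℕ)

/-- `S¹_x` and `S³_x` are real symmetric in the `S³` eigenbasis: `(S^α_x)ᵀ = S^α_x` for `α ≠ 1`
([LiebSchupp1999] p. 2: "a real orthonormal basis of `S³` eigenstates … real, symmetric matrix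
elements"). [cite: LiebSchupp1999, p. 2] -/
theorem siteSpin_transpose_of_ne_one (x : Λ) {α : Fin 3} (hα : α ≠ 1) :
    (siteSpin n x α : Op Λ (n + 1))ᵀ = siteSpin n x α := by
  have hreal : (siteSpin n x α : Op Λ (n + 1))ᵀ = (siteSpin n x α)ᴴ := by
    fin_cases α
    · exact siteSpin_zero_transpose_eq n x
    · exact absurd rfl hα
    · exact siteSpin_two_transpose_eq n x
  rw [hreal, (siteSpin_isHermitian n x α).eq]

/-- `S²_x` is imaginary antisymmetric in the `S³` eigenbasis: `(S²_x)ᵀ = -S²_x` ([LiebSchupp1999]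
p. 2: "`t^{(2)} = i⟨ψ|s^{(2)}|ψ⟩` … real matrices"). [cite: LiebSchupp1999, p. 2] -/
theorem siteSpin_one_transpose (x : Λ) :
    (siteSpin n x 1 : Op Λ (n + 1))ᵀ = -siteSpin n x 1 := by
  have h := I_smul_siteSpin_one_transpose_eq (Λ := Λ) n x
  rw [transpose_smul, conjTranspose_smul, (siteSpin_isHermitian n x 1).eq, Complex.star_def,
    Complex.conj_I, neg_smul] at h
  have h2 := congrArg (fun X : Op Λ (n + 1) => (-Complex.I) • X) h
  simp only [smul_neg, smul_smul] at h2
  rw [show -Complex.I * Complex.I = 1 by rw [neg_mul, Complex.I_mul_I, neg_neg], one_smul, one_smul] at h2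
  exact h2

/-- The real single-site matrices `T^α_x`: `T¹ = S¹`, `T² = iS²`, `T³ = S³` ([KLS1988JSP] eq. (16);
[LiebSchupp1999] p. 2: "`t^{(2)} = i⟨ψ|s^{(2)}|ψ⟩`"). [cite: LiebSchupp1999, p. 2] -/
def lsRealSpin (x : Λ) (α : Fin 3) : Op Λ (n + 1) :=
  (if α = 1 then Complex.I else 1) • siteSpin n x α

/-- `T^α_x` is a real matrix. [cite: KLS1988JSP, eq. (16)] -/
theorem lsRealSpin_transpose_eq (x : Λ) (α : Fin 3) :
    (lsRealSpin n x α)ᵀ = (lsRealSpin n x α)ᴴ := by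
  unfold lsRealSpin
  fin_cases α
  · simp only [Fin.zero_eta, Fin.isValue, zero_ne_one, ↓reduceIte, one_smul]
    exact siteSpin_zero_transpose_eq n x
  · simp only [Fin.mk_one, Fin.isValue, ↓reduceIte]
    exact I_smul_siteSpin_one_transpose_eq n x
  · simp only [Fin.reduceFinMk, Fin.isValue, show (2 : Fin 3) ≠ 1 by decide, ↓reduceIte, one_smul]
    exact siteSpin_two_transpose_eq n x

/-- For `α ≠ 1`, `T^α_x = S^α_x` is symmetric. [folklore] -/
private theorem lsRealSpin_of_ne_one (x : Λ) {α : Fin 3} (hα : α ≠ 1) :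
    lsRealSpin n x α = siteSpin n x α := by
  rw [lsRealSpin, if_neg hα, one_smul]

/-- `𝐒_x·𝐒_y` (symmetrised) is a real matrix in the `S³` eigenbasis ([LiebSchupp1999] p. 2: `h_L`,
`h_R` have "real, symmetric matrix elements"). [cite: LiebSchupp1999, p. 2] -/
theorem spinDot_transpose_eq (x y : Λ) : (spinDot n x y)ᵀ = (spinDot n x y)ᴴ := by
  have h0x := siteSpin_zero_transpose_eq (Λ := Λ) n x
  have h0y := siteSpin_zero_transpose_eq (Λ := Λ) n y
  have hhalf : (1 / 2 : ℂ) = ((1 / 2 : ℝ) : ℂ) := by push_cast; ring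
  unfold spinDot
  rw [Fin.sum_univ_three]
  refine transpose_eq_conjTranspose_add (transpose_eq_conjTranspose_add ?_ ?_)
    (spinBond_two_transpose_eq n x y)
  · unfold spinBond
    rw [hhalf]
    exact transpose_eq_conjTranspose_ofReal_smul (transpose_eq_conjTranspose_add
      (transpose_eq_conjTranspose_mul h0x h0y) (transpose_eq_conjTranspose_mul h0y h0x)) _
  · unfold spinBond
    rw [hhalf]
    exact transpose_eq_conjTranspose_ofReal_smul (transpose_eq_conjTranspose_add
      (siteSpin_one_mul_transpose_eq n x y) (siteSpin_one_mul_transpose_eq n y x)) _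

/-- `𝐒_x·𝐒_y` is a real symmetric matrix: `(𝐒_x·𝐒_y)ᵀ = 𝐒_x·𝐒_y`. [cite: LiebSchupp1999, p. 2] -/
theorem spinDot_transpose (x y : Λ) : (spinDot n x y)ᵀ = spinDot n x y := by
  rw [spinDot_transpose_eq, (spinDot_isHermitian n x y).eq]

end Reality

/-! ### §3. The right-half rotation by `π` about the `2`-axis ([LiebSchupp1999] p. 2) -/

section Rotation

variable (L : ℕ) [NeZero L] (j : Fin d) (a : ZMod L) (n : ℕ)

/-- The sign picked up by `S^α_x` under the right-half rotation: `+1` on the left half and for the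
`2`-component, `-1` for the `1`- and `3`-components on the right half ([LiebSchupp1999] p. 2:
"This rotation … reverses the signs of the operators `S¹` and `S³`, while it keeps `S²`
unchanged"). [cite: LiebSchupp1999, p. 2] -/
def rhSign (x : TorusSite d L) (α : Fin 3) : ℂ :=
  if x ∈ torusLeftHalf L j a ∨ α = 1 then 1 else -1

/-- On the left half the sign is `1` (the left subsystem is not rotated). [cite: LiebSchupp1999, p. 2] -/
theorem rhSign_of_mem {x : TorusSite d L} (hx : x ∈ torusLeftHalf L j a) (α : Fin 3) :
    rhSign L j a x α = 1 := by
  unfold rhSign; rw [if_pos (Or.inl hx)]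

/-- On the right half the sign is `-1` for the components `α ≠ 1` ("reverses the signs of the
operators `S¹` and `S³`"). [cite: LiebSchupp1999, p. 2] -/
theorem rhSign_of_not_mem {x : TorusSite d L} (hx : x ∉ torusLeftHalf L j a) {α : Fin 3}
    (hα : α ≠ 1) : rhSign L j a x α = -1 := by
  unfold rhSign; rw [if_neg (not_or.2 ⟨hx, hα⟩)]

/-- For the `2`-component the sign is `1` ("keeps `S²` unchanged"). [cite: LiebSchupp1999, p. 2] -/
theorem rhSign_one (x : TorusSite d L) : rhSign L j a x 1 = 1 := by
  unfold rhSign; rw [if_pos (Or.inr rfl)]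

/-- **The right-half rotation** ([LiebSchupp1999] p. 2; [LiebSchupp2000] §2 "the tilde shall
henceforth denote the rotation by `π` around the 2-axis in spin-space"): a unitary `W` (the
product of the single-site rotations by `π` about the `2`-axis over the right half) with
`W S^α_x Wᴴ = rhSign(x, α) · S^α_x`. [cite: LiebSchupp1999, p. 2] -/
theorem exists_rightHalfRotation :
    ∃ W : Op (TorusSite d L) (n + 1), W * Wᴴ = 1 ∧ Wᴴ * W = 1 ∧
      ∀ (x : TorusSite d L) (α : Fin 3), W * siteSpin n x α * Wᴴ = rhSign L j a x α • siteSpin n x α := by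
  -- the single-site rotation `R = V²` (`π` about the `2`-axis): `Sˣ ↦ -Sˣ`, `Sʸ ↦ Sʸ`, `Sᶻ ↦ -Sᶻ`
  obtain ⟨V, hV, hV', hVz, hVx, hVy⟩ := exists_unitary_conj_spinZ_eq_spinX n
  set R := V * V with hR
  have hRR : R * Rᴴ = 1 := by
    rw [hR, conjTranspose_mul, Matrix.mul_assoc, ← Matrix.mul_assoc V Vᴴ, hV, Matrix.one_mul, hV]
  have hRR' : Rᴴ * R = 1 := by
    rw [hR, conjTranspose_mul, Matrix.mul_assoc, ← Matrix.mul_assoc Vᴴ V, hV', Matrix.one_mul, hV']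
  have hRz : R * SpinOperators.spinZ n * Rᴴ = -SpinOperators.spinZ n := by
    rw [hR, conjTranspose_mul, show V * V * SpinOperators.spinZ n * (Vᴴ * Vᴴ) =
      V * (V * SpinOperators.spinZ n * Vᴴ) * Vᴴ by simp only [Matrix.mul_assoc], hVz, hVx]
  have hRy : R * spinY n * Rᴴ = spinY n := by
    rw [hR, conjTranspose_mul, show V * V * spinY n * (Vᴴ * Vᴴ) =
      V * (V * spinY n * Vᴴ) * Vᴴ by simp only [Matrix.mul_assoc], hVy, hVy]
  have hRx : R * spinX n * Rᴴ = -spinX n := by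
    rw [hR, conjTranspose_mul, show V * V * spinX n * (Vᴴ * Vᴴ) =
      V * (V * spinX n * Vᴴ) * Vᴴ by simp only [Matrix.mul_assoc], hVx, Matrix.mul_neg,
      Matrix.neg_mul, hVz]
  have hRα : ∀ α : Fin 3, R * spinVec n α * Rᴴ = (if α = 1 then (1 : ℂ) else -1) • spinVec n α := by
    intro α
    fin_cases α
    · simp only [spinVec_zero, Fin.zero_eta, Fin.isValue, zero_ne_one, ↓reduceIte, neg_smul, one_smul]
      exact hRx
    · simp only [spinVec_one, Fin.mk_one, Fin.isValue, ↓reduceIte, one_smul]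
      exact hRy
    · simp only [spinVec_two, Fin.reduceFinMk, Fin.isValue, show (2 : Fin 3) ≠ 1 by decide, ↓reduceIte,
        neg_smul, one_smul]
      exact hRz
  -- the product unitary over the right half
  set u : TorusSite d L → Matrix (Fin (n + 1)) (Fin (n + 1)) ℂ :=
    fun z => if z ∈ torusLeftHalf L j a then 1 else R with hu
  have hua : ∀ z, u z * (u z)ᴴ = 1 := by
    intro z; simp only [hu]; split_ifs
    · rw [conjTranspose_one, Matrix.mul_one]
    · exact hRR
  have hub : ∀ z, (u z)ᴴ * u z = 1 := by
    intro z; simp only [hu]; split_ifs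
    · rw [conjTranspose_one, Matrix.mul_one]
    · exact hRR'
  refine ⟨productOp u, productOp_mul_conjTranspose hua, productOp_conjTranspose_mul hub, fun x α => ?_⟩
  rw [productOp_conj_siteSpin hua, siteSpin, ← onSite_smul']
  congr 1
  simp only [hu, rhSign]
  by_cases hx : x ∈ torusLeftHalf L j a
  · rw [if_pos hx, if_pos (Or.inl hx), conjTranspose_one, Matrix.mul_one, Matrix.one_mul, one_smul]
  · rw [if_neg hx, hRα]
    by_cases hα : α = 1
    · rw [if_pos hα, if_pos (Or.inr hα)]
    · rw [if_neg hα, if_neg (not_or.2 ⟨hx, hα⟩)]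

variable {L j a n}

/-- Conjugation by a unitary is multiplicative. [folklore] -/
private theorem conj_mul_of_unitary {W : Op (TorusSite d L) (n + 1)} (hW' : Wᴴ * W = 1)
    (A B : Op (TorusSite d L) (n + 1)) : W * (A * B) * Wᴴ = (W * A * Wᴴ) * (W * B * Wᴴ) := by
  simp only [Matrix.mul_assoc]
  rw [← Matrix.mul_assoc Wᴴ W, hW', Matrix.one_mul]

/-- **The rotation on bond operators**: `W ½(S^α_xS^α_y + S^α_yS^α_x) Wᴴ =
rhSign(x,α) rhSign(y,α) · ½(S^α_xS^α_y + S^α_yS^α_x)`. [cite: LiebSchupp1999, p. 2] -/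
theorem conj_spinBond_of_rotation {W : Op (TorusSite d L) (n + 1)} (hW' : Wᴴ * W = 1)
    (hWS : ∀ (x : TorusSite d L) (α : Fin 3), W * siteSpin n x α * Wᴴ = rhSign L j a x α • siteSpin n x α)
    (α : Fin 3) (x y : TorusSite d L) :
    W * spinBond n α x y * Wᴴ = (rhSign L j a x α * rhSign L j a y α) • spinBond n α x y := by
  rw [spinBond, Matrix.mul_smul, Matrix.smul_mul, Matrix.mul_add, Matrix.add_mul,
    conj_mul_of_unitary hW', conj_mul_of_unitary hW', hWS, hWS, smul_mul_smul_comm, smul_mul_smul_comm,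
    mul_comm (rhSign L j a y α), ← smul_add, smul_comm]

/-- **Bonds within one half are invariant**: `W (𝐒_x·𝐒_y) Wᴴ = 𝐒_x·𝐒_y` if `x`, `y` lie on the same
side. [cite: LiebSchupp1999, p. 2] -/
theorem conj_spinDot_of_same {W : Op (TorusSite d L) (n + 1)} (hW' : Wᴴ * W = 1)
    (hWS : ∀ (x : TorusSite d L) (α : Fin 3), W * siteSpin n x α * Wᴴ = rhSign L j a x α • siteSpin n x α)
    {x y : TorusSite d L} (hxy : x ∈ torusLeftHalf L j a ↔ y ∈ torusLeftHalf L j a) :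
    W * spinDot n x y * Wᴴ = spinDot n x y := by
  rw [spinDot, Finset.mul_sum, Finset.sum_mul]
  refine sum_congr rfl fun α _ => ?_
  rw [conj_spinBond_of_rotation hW' hWS]
  have h1 : rhSign L j a x α * rhSign L j a y α = 1 := by
    by_cases hx : x ∈ torusLeftHalf L j a
    · rw [rhSign_of_mem L j a hx, rhSign_of_mem L j a (hxy.1 hx), one_mul]
    · have hy : y ∉ torusLeftHalf L j a := fun h => hx (hxy.2 h)
      by_cases hα : α = 1
      · rw [hα, rhSign_one, rhSign_one, one_mul]
      · rw [rhSign_of_not_mem L j a hx hα, rhSign_of_not_mem L j a hy hα]; norm_num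
  rw [h1, one_smul]

/-- **Crossing bonds change sign in the components `1`, `3`**: `W (𝐒_x·𝐒_y) Wᴴ =
-S¹S¹ + S²S² - S³S³` if `x`, `y` lie on opposite sides ([LiebSchupp1999] eq. (ev): "Note the
overall minus sign of the crossing term"). [cite: LiebSchupp1999, p. 2] -/
theorem conj_spinDot_of_cross {W : Op (TorusSite d L) (n + 1)} (hW' : Wᴴ * W = 1)
    (hWS : ∀ (x : TorusSite d L) (α : Fin 3), W * siteSpin n x α * Wᴴ = rhSign L j a x α • siteSpin n x α)
    {x y : TorusSite d L} (hxy : ¬ (x ∈ torusLeftHalf L j a ↔ y ∈ torusLeftHalf L j a)) :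
    W * spinDot n x y * Wᴴ = lsCrossBond n x y := by
  have hsgn : ∀ α : Fin 3, rhSign L j a x α * rhSign L j a y α = if α = 1 then (1 : ℂ) else -1 := by
    intro α
    by_cases hα : α = 1
    · rw [hα, rhSign_one, rhSign_one, one_mul, if_pos rfl]
    rw [if_neg hα]
    by_cases hx : x ∈ torusLeftHalf L j a
    · have hy : y ∉ torusLeftHalf L j a := fun h => hxy ⟨fun _ => h, fun _ => hx⟩
      rw [rhSign_of_mem L j a hx, rhSign_of_not_mem L j a hy hα, one_mul]
    · have hy : y ∈ torusLeftHalf L j a := by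
        by_contra h; exact hxy ⟨fun h' => absurd h' hx, fun h' => absurd h' h⟩
      rw [rhSign_of_not_mem L j a hx hα, rhSign_of_mem L j a hy, mul_one]
  rw [spinDot, Finset.mul_sum, Finset.sum_mul, Fin.sum_univ_three, conj_spinBond_of_rotation hW' hWS,
    conj_spinBond_of_rotation hW' hWS, conj_spinBond_of_rotation hW' hWS, hsgn, hsgn, hsgn]
  simp only [Fin.isValue, zero_ne_one, ↓reduceIte, neg_smul, one_smul, show (2 : Fin 3) ≠ 1 by decide,
    lsCrossBond]
  abel

end Rotation

/-! ### §4. The rotated Hamiltonian and its Kronecker form ([LiebSchupp2000] §2) -/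

section KroneckerForm

variable (L : ℕ) [NeZero L] (j : Fin d) (a : ZMod L) (n : ℕ)

/-- **The rotated Hamiltonian** `W H_J Wᴴ`: same-side pairs keep `𝐒_x·𝐒_y`, crossing pairs
carry the rotated bond `-S¹S¹ + S²S² - S³S³`. [cite: LiebSchupp1999, p. 2, eq. (ev)] -/
def pairHeisenbergRot (J : TorusSite d L → TorusSite d L → ℝ) : Op (TorusSite d L) (n + 1) :=
  ∑ x, ∑ y, ((J x y / 2 : ℝ) : ℂ) •
    (if (x ∈ torusLeftHalf L j a ↔ y ∈ torusLeftHalf L j a) then spinDot n x y else lsCrossBond n x y)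

/-- **`H_L`** — the left Hamiltonian on the state space of the left half (`H_L = h ⊗ 1`,
[LiebSchupp2000] §2): `½ Σ_{s,s' ∈ Λ_L} J(s,s') 𝐒_s·𝐒_{s'}`. [cite: LiebSchupp2000, §2] -/
def lsLeftHamiltonian (J : TorusSite d L → TorusSite d L → ℝ) : Op (torusLeftHalf L j a) (n + 1) :=
  ∑ s : torusLeftHalf L j a, ∑ s' : torusLeftHalf L j a,
    ((J (s : TorusSite d L) (s' : TorusSite d L) / 2 : ℝ) : ℂ) • spinDot n s s'

/-- **The crossing operators** `M_{k,α} = Σ_{s ∈ Λ_L} v_k(s) T^α_s` ([LiebSchupp2000] §2: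
`(S_A^{(a)})_{αβ} = ⟨ψ_α| Σ_{i∈A} jᵢ s^{(a)}ᵢ |ψ_β⟩`, with the factor `i` on the `2`-component).
[cite: LiebSchupp2000, §2] -/
def lsCrossOp {κ : Type*} (v : κ → TorusSite d L → ℝ) (kα : κ × Fin 3) :
    Op (torusLeftHalf L j a) (n + 1) :=
  ∑ s : torusLeftHalf L j a, (v kα.1 (s : TorusSite d L) : ℂ) • lsRealSpin n s kα.2

/-- **The ice operator** of the crossing unit `k` in the component `α`:
`O_{k,α} = Σ_{s ∈ Λ_L} v_k(s)(S^α_s + S^α_{θs})` — the operator `Σ_{i∈B} jᵢ(s^{(3)}ᵢ + s^{(3)}_{i'})`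
of [LiebSchupp2000] eq. (ice) (there for the third component). [cite: LiebSchupp2000, §7] -/
def lsIceOp {κ : Type*} (v : κ → TorusSite d L → ℝ) (k : κ) (α : Fin 3) :
    Op (TorusSite d L) (n + 1) :=
  ∑ s ∈ torusLeftHalf L j a,
    (v k s : ℂ) • (siteSpin n s α + siteSpin n (Torus.reflectBetweenSites j a s) α)

variable {L j a n}

/-- `H_L` is a real matrix. [cite: LiebSchupp1999, p. 2 ("real, symmetric matrix elements")] -/
theorem lsLeftHamiltonian_transpose_eq (J : TorusSite d L → TorusSite d L → ℝ) :
    (lsLeftHamiltonian L j a n J)ᵀ = (lsLeftHamiltonian L j a n J)ᴴ := by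
  unfold lsLeftHamiltonian
  refine transpose_eq_conjTranspose_sum _ fun s _ => transpose_eq_conjTranspose_sum _ fun s' _ => ?_
  exact transpose_eq_conjTranspose_ofReal_smul (spinDot_transpose_eq n s s') _

/-- `H_L` is Hermitian. [cite: LiebSchupp2000, §2] -/
theorem lsLeftHamiltonian_isHermitian (J : TorusSite d L → TorusSite d L → ℝ) :
    (lsLeftHamiltonian L j a n J).IsHermitian := by
  unfold lsLeftHamiltonian
  refine ls_isHermitian_sum fun s _ => ls_isHermitian_sum fun s' _ => ?_
  exact (spinDot_isHermitian n s s').ofReal_smul _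

/-- `H_L` is real symmetric: `H_Lᵀ = H_L`. [cite: LiebSchupp1999, p. 2] -/
theorem lsLeftHamiltonian_transpose (J : TorusSite d L → TorusSite d L → ℝ) :
    (lsLeftHamiltonian L j a n J)ᵀ = lsLeftHamiltonian L j a n J := by
  rw [lsLeftHamiltonian_transpose_eq, (lsLeftHamiltonian_isHermitian J).eq]

/-- The crossing operators are real matrices. [cite: LiebSchupp1999, p. 2 ("the `t_y^{(i)}` are the
real matrices")] -/
theorem lsCrossOp_transpose_eq {κ : Type*} (v : κ → TorusSite d L → ℝ) (kα : κ × Fin 3) :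
    (lsCrossOp L j a n v kα)ᵀ = (lsCrossOp L j a n v kα)ᴴ := by
  unfold lsCrossOp
  exact transpose_eq_conjTranspose_sum _ fun s _ =>
    transpose_eq_conjTranspose_ofReal_smul (lsRealSpin_transpose_eq n s kα.2) _

/-- For the components `α ≠ 1` the crossing operator is real SYMMETRIC (a real combination of
the symmetric `S¹_s` or of the diagonal `S³_s`; [LiebSchupp1999] p. 2, the real matrices
`t^{(1,3)} = ⟨ψ_α|s^{(1,3)}_1 + s^{(1,3)}_2|ψ_β⟩`). [cite: LiebSchupp1999, p. 2] -/
theorem lsCrossOp_transpose_of_ne_one {κ : Type*} (v : κ → TorusSite d L → ℝ) (k : κ) {α : Fin 3}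
    (hα : α ≠ 1) : (lsCrossOp L j a n v (k, α))ᵀ = lsCrossOp L j a n v (k, α) := by
  unfold lsCrossOp
  rw [transpose_sum]
  refine sum_congr rfl fun s _ => ?_
  rw [transpose_smul, lsRealSpin_of_ne_one n s hα, siteSpin_transpose_of_ne_one n s hα]

/-- The ice operator is Hermitian. [cite: LiebSchupp2000, §7] -/
theorem lsIceOp_isHermitian {κ : Type*} (v : κ → TorusSite d L → ℝ) (k : κ) (α : Fin 3) :
    (lsIceOp L j a n v k α).IsHermitian := by
  unfold lsIceOp
  refine ls_isHermitian_sum fun s _ => ?_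
  exact ((siteSpin_isHermitian n s α).add (siteSpin_isHermitian n _ α)).ofReal_smul _

/-- The ice operator commutes with `H_J`? No — only its expectation is constrained. What we need is
that it is a sum of single-site spins; here: its conjugate under the rotation, for `α ≠ 1`:
`W O_{k,α} Wᴴ = Σ_s v_k(s)(S^α_s - S^α_{θs})`. [cite: LiebSchupp2000, §7] -/
theorem conj_lsIceOp_of_ne_one (hL : Even L) {W : Op (TorusSite d L) (n + 1)}
    (hWS : ∀ (x : TorusSite d L) (α : Fin 3), W * siteSpin n x α * Wᴴ = rhSign L j a x α • siteSpin n x α)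
    {κ : Type*} (v : κ → TorusSite d L → ℝ) (k : κ) {α : Fin 3} (hα : α ≠ 1) :
    W * lsIceOp L j a n v k α * Wᴴ =
      ∑ s ∈ torusLeftHalf L j a,
        (v k s : ℂ) • (siteSpin n s α - siteSpin n (Torus.reflectBetweenSites j a s) α) := by
  rw [lsIceOp, Finset.mul_sum, Finset.sum_mul]
  refine sum_congr rfl fun s hs => ?_
  have hθs : Torus.reflectBetweenSites j a s ∉ torusLeftHalf L j a := fun h =>
    (reflectBetweenSites_mem_torusLeftHalf_iff L j a hL s).1 h hs
  rw [Matrix.mul_smul, Matrix.smul_mul, Matrix.mul_add, Matrix.add_mul, hWS, hWS, rhSign_of_mem L j a hs,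
    rhSign_of_not_mem L j a hθs hα, one_smul, neg_one_smul, ← sub_eq_add_neg]

/-! #### Embedded spins and the splitting of site sums -/

variable (L j a n)

/-- `S^α_s ⊗ 1 = S^α_s` for a left site `s`. [cite: KLS1988JSP, p. 1028] -/
theorem torusLeftEmbed_siteSpin (hL : Even L) (s : torusLeftHalf L j a) (α : Fin 3) :
    torusLeftEmbed L j a hL (siteSpin n s α) = siteSpin n (s : TorusSite d L) α := by
  rw [siteSpin_eq_torusLeftEmbed (hL := hL) n s.2 α, torusToLeft_of_mem L j a hL s.2]

/-- `1 ⊗ S^α_s = S^α_{θs}` for a left site `s`. [cite: KLS1988JSP, p. 1028] -/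
theorem torusRightEmbed_siteSpin (hL : Even L) (s : torusLeftHalf L j a) (α : Fin 3) :
    torusRightEmbed L j a hL (siteSpin n s α) =
      siteSpin n (Torus.reflectBetweenSites j a (s : TorusSite d L)) α := by
  have hθ : Torus.reflectBetweenSites j a (s : TorusSite d L) ∉ torusLeftHalf L j a := fun h =>
    (reflectBetweenSites_mem_torusLeftHalf_iff L j a hL (s : TorusSite d L)).1 h s.2
  rw [siteSpin_eq_torusRightEmbed (hL := hL) n hθ α, torusToLeft_reflectBetweenSites,
    torusToLeft_of_mem L j a hL s.2]

/-- `𝐒_s·𝐒_{s'} ⊗ 1 = 𝐒_s·𝐒_{s'}` for left sites. [cite: KLS1988JSP, eq. (21)] -/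
theorem torusLeftEmbed_spinDot (hL : Even L) (s s' : torusLeftHalf L j a) :
    torusLeftEmbed L j a hL (spinDot n s s') = spinDot n (s : TorusSite d L) (s' : TorusSite d L) := by
  simp only [spinDot, spinBond, map_sum, map_smul, map_add, map_mul, torusLeftEmbed_siteSpin]

/-- `1 ⊗ 𝐒_s·𝐒_{s'} = 𝐒_{θs}·𝐒_{θs'}`. [cite: KLS1988JSP, eq. (21)] -/
theorem torusRightEmbed_spinDot (hL : Even L) (s s' : torusLeftHalf L j a) :
    torusRightEmbed L j a hL (spinDot n s s') =
      spinDot n (Torus.reflectBetweenSites j a (s : TorusSite d L))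
        (Torus.reflectBetweenSites j a (s' : TorusSite d L)) := by
  simp only [spinDot, spinBond, map_sum, map_smul, map_add, map_mul, torusRightEmbed_siteSpin]

/-- **The crossing bond as a product of embedded real spins** ([LiebSchupp1999] eq. (ev):
`-Σᵢ t^{(i)} c (t^{(i)})ᵀ`): for left sites `s`, `s'`,
`(-S¹S¹ + S²S² - S³S³)(s, θs') = -Σ_α (T^α_s ⊗ 1)(1 ⊗ T^α_{s'})`. [cite: LiebSchupp1999, eq. (ev)] -/
theorem lsCrossBond_eq_sum_embed (hL : Even L) (s s' : torusLeftHalf L j a) :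
    lsCrossBond n (s : TorusSite d L) (Torus.reflectBetweenSites j a (s' : TorusSite d L)) =
      -∑ α : Fin 3, torusLeftEmbed L j a hL (lsRealSpin n s α) * torusRightEmbed L j a hL (lsRealSpin n s' α) := by
  -- the two embedded factors commute and their symmetrised product is their product
  have hbond : ∀ α : Fin 3, spinBond n α (s : TorusSite d L)
      (Torus.reflectBetweenSites j a (s' : TorusSite d L)) =
      torusLeftEmbed L j a hL (siteSpin n s α) * torusRightEmbed L j a hL (siteSpin n s' α) := by
    intro α
    rw [spinBond, ← torusLeftEmbed_siteSpin L j a n hL s α, ← torusRightEmbed_siteSpin L j a n hL s' α,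
      torusLeftEmbed_mul_torusRightEmbed, torusRightEmbed_mul_torusLeftEmbed, ← two_smul ℂ, smul_smul]
    norm_num
  rw [lsCrossBond, Fin.sum_univ_three, hbond, hbond, hbond]
  simp only [lsRealSpin, Fin.isValue, zero_ne_one, ↓reduceIte, one_smul, show (2 : Fin 3) ≠ 1 by decide,
    map_smul, smul_mul_smul_comm, Complex.I_mul_I, neg_smul, one_smul]
  abel

/-- **Splitting a site sum over the two halves**: `Σ_x f(x) = Σ_{s ∈ Λ_L} f(s) + Σ_{s ∈ Λ_L} f(θs)`
(even `L`). [cite: KLS1988JSP, p. 1027] -/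
theorem sum_torus_eq_sum_half (hL : Even L) {M : Type*} [AddCommMonoid M] (f : TorusSite d L → M) :
    ∑ x, f x = ∑ s : torusLeftHalf L j a, f s +
      ∑ s : torusLeftHalf L j a, f (Torus.reflectBetweenSites j a (s : TorusSite d L)) := by
  rw [Finset.sum_coe_sort (torusLeftHalf L j a) f,
    Finset.sum_coe_sort (torusLeftHalf L j a) (fun x => f (Torus.reflectBetweenSites j a x)),
    ← Finset.sum_add_sum_compl (torusLeftHalf L j a) f]
  congr 1
  refine (Finset.sum_nbij' (Torus.reflectBetweenSites j a) (Torus.reflectBetweenSites j a)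
    (fun x hx => ?_) (fun x hx => ?_) (fun x _ => Torus.reflectBetweenSites_involutive j a x)
    (fun x _ => Torus.reflectBetweenSites_involutive j a x) (fun x _ => rfl)).symm
  · rw [Finset.mem_compl]
    exact fun h => (reflectBetweenSites_mem_torusLeftHalf_iff L j a hL x).1 h hx
  · exact (reflectBetweenSites_mem_torusLeftHalf_iff L j a hL x).2 (Finset.mem_compl.1 hx)

variable {L j a n}

/-- **The Kronecker form of the rotated Hamiltonian** ([LiebSchupp2000] §2, the display for
`⟨ψ|H|ψ⟩ = tr cc†h + tr (c†c)ᵀh̃ - Σ_A Σ_a tr c†S_A^{(a)} c (S_A^{(a)})†`; [LiebSchupp1999] eq. (ev)):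
if `J` is symmetric and reflection invariant and the crossing couplings are a sum of squares,
`J(s, θs') = Σ_k v_k(s) v_k(s')` on the left half, then
`W H_J Wᴴ = (H_L ⊗ 1 + 1 ⊗ H_L - Σ_{k,α} M_{kα} ⊗ M_{kα})` in the tensor-square identification.
[cite: LiebSchupp2000, §2] [cite: LiebSchupp1999, eq. (ev)] -/
theorem pairHeisenbergRot_eq_submatrix (hL : Even L) {J : TorusSite d L → TorusSite d L → ℝ}
    (hJs : ∀ x y, J x y = J y x)
    (hJθ : ∀ x y, J (Torus.reflectBetweenSites j a x) (Torus.reflectBetweenSites j a y) = J x y)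
    {κ : Type*} [Fintype κ] (v : κ → TorusSite d L → ℝ)
    (hC : ∀ s ∈ torusLeftHalf L j a, ∀ s' ∈ torusLeftHalf L j a,
      J s (Torus.reflectBetweenSites j a s') = ∑ k, v k s * v k s') :
    pairHeisenbergRot L j a n J =
      (lsLeftHamiltonian L j a n J ⊗ₖ (1 : Op (torusLeftHalf L j a) (n + 1)) +
        (1 : Op (torusLeftHalf L j a) (n + 1)) ⊗ₖ lsLeftHamiltonian L j a n J -
        ∑ kα : κ × Fin 3, lsCrossOp L j a n v kα ⊗ₖ lsCrossOp L j a n v kα).submatrix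
        (torusSplit L j a hL) (torusSplit L j a hL) := by
  have hmemθ : ∀ s : torusLeftHalf L j a, Torus.reflectBetweenSites j a (s : TorusSite d L) ∉ torusLeftHalf L j a := fun s h =>
    (reflectBetweenSites_mem_torusLeftHalf_iff L j a hL (s : TorusSite d L)).1 h s.2
  rw [submatrix_kroneckerForm]
  -- the left and right blocks
  have hLL : torusLeftEmbed L j a hL (lsLeftHamiltonian L j a n J) =
      ∑ s : torusLeftHalf L j a, ∑ s' : torusLeftHalf L j a,
        ((J s s' / 2 : ℝ) : ℂ) • spinDot n (s : TorusSite d L) (s' : TorusSite d L) := by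
    simp only [lsLeftHamiltonian, map_sum, map_smul, torusLeftEmbed_spinDot]
  have hRR : torusRightEmbed L j a hL (lsLeftHamiltonian L j a n J) =
      ∑ s : torusLeftHalf L j a, ∑ s' : torusLeftHalf L j a,
        ((J (Torus.reflectBetweenSites j a s) (Torus.reflectBetweenSites j a s') / 2 : ℝ) : ℂ) • spinDot n (Torus.reflectBetweenSites j a s) (Torus.reflectBetweenSites j a s') := by
    simp only [lsLeftHamiltonian, map_sum, map_smul, torusRightEmbed_spinDot]
    simp only [hJθ]
  -- the crossing block
  have hX : ∑ kα : κ × Fin 3, torusLeftEmbed L j a hL (lsCrossOp L j a n v kα) *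
        torusRightEmbed L j a hL (lsCrossOp L j a n v kα) =
      ∑ s : torusLeftHalf L j a, ∑ s' : torusLeftHalf L j a,
        ((J s (Torus.reflectBetweenSites j a s') : ℝ) : ℂ) • ∑ α : Fin 3,
          torusLeftEmbed L j a hL (lsRealSpin n s α) * torusRightEmbed L j a hL (lsRealSpin n s' α) := by
    have hexp : ∀ kα : κ × Fin 3, torusLeftEmbed L j a hL (lsCrossOp L j a n v kα) *
        torusRightEmbed L j a hL (lsCrossOp L j a n v kα) =
        ∑ s : torusLeftHalf L j a, ∑ s' : torusLeftHalf L j a,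
          ((v kα.1 s * v kα.1 s' : ℝ) : ℂ) •
            (torusLeftEmbed L j a hL (lsRealSpin n s kα.2) * torusRightEmbed L j a hL (lsRealSpin n s' kα.2)) := by
      intro kα
      simp only [lsCrossOp, map_sum, map_smul, Finset.sum_mul, Finset.mul_sum, smul_mul_smul_comm,
        Complex.ofReal_mul]
      rw [Finset.sum_comm]
    simp only [hexp]
    rw [Finset.sum_comm]
    refine sum_congr rfl fun s _ => ?_
    rw [Finset.sum_comm]
    refine sum_congr rfl fun s' _ => ?_
    rw [hC s s.2 s' s'.2, Fintype.sum_prod_type, Finset.smul_sum]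
    simp only [Complex.ofReal_sum, Complex.ofReal_mul, Finset.sum_smul]
    rw [Finset.sum_comm]
  -- the rotated Hamiltonian, split over the halves
  have hsplit : pairHeisenbergRot L j a n J =
      (∑ s : torusLeftHalf L j a, ∑ s' : torusLeftHalf L j a,
          ((J s s' / 2 : ℝ) : ℂ) • spinDot n (s : TorusSite d L) (s' : TorusSite d L)) +
        (∑ s : torusLeftHalf L j a, ∑ s' : torusLeftHalf L j a,
          ((J s (Torus.reflectBetweenSites j a s') / 2 : ℝ) : ℂ) • lsCrossBond n (s : TorusSite d L) (Torus.reflectBetweenSites j a s')) +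
        ((∑ s : torusLeftHalf L j a, ∑ s' : torusLeftHalf L j a,
          ((J (Torus.reflectBetweenSites j a s) s' / 2 : ℝ) : ℂ) • lsCrossBond n (Torus.reflectBetweenSites j a s) (s' : TorusSite d L)) +
        ∑ s : torusLeftHalf L j a, ∑ s' : torusLeftHalf L j a,
          ((J (Torus.reflectBetweenSites j a s) (Torus.reflectBetweenSites j a s') / 2 : ℝ) : ℂ) • spinDot n (Torus.reflectBetweenSites j a s) (Torus.reflectBetweenSites j a s')) := by
    unfold pairHeisenbergRot
    rw [sum_torus_eq_sum_half L j a hL]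
    congr 1
    · rw [← Finset.sum_add_distrib]
      refine sum_congr rfl fun s _ => ?_
      rw [sum_torus_eq_sum_half L j a hL]
      congr 1
      · refine sum_congr rfl fun s' _ => ?_
        rw [if_pos (iff_of_true s.2 s'.2)]
      · refine sum_congr rfl fun s' _ => ?_
        rw [if_neg (fun h => hmemθ s' (h.1 s.2))]
    · rw [← Finset.sum_add_distrib]
      refine sum_congr rfl fun s _ => ?_
      rw [sum_torus_eq_sum_half L j a hL]
      congr 1
      · refine sum_congr rfl fun s' _ => ?_
        rw [if_neg (fun h => hmemθ s (h.2 s'.2))]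
      · refine sum_congr rfl fun s' _ => ?_
        rw [if_pos (iff_of_false (hmemθ s) (hmemθ s'))]
  -- the two crossing blocks coincide
  have hcross : (∑ s : torusLeftHalf L j a, ∑ s' : torusLeftHalf L j a,
        ((J (Torus.reflectBetweenSites j a s) s' / 2 : ℝ) : ℂ) • lsCrossBond n (Torus.reflectBetweenSites j a s) (s' : TorusSite d L)) =
      ∑ s : torusLeftHalf L j a, ∑ s' : torusLeftHalf L j a,
        ((J s (Torus.reflectBetweenSites j a s') / 2 : ℝ) : ℂ) • lsCrossBond n (s : TorusSite d L) (Torus.reflectBetweenSites j a s') := by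
    rw [Finset.sum_comm]
    refine sum_congr rfl fun s _ => sum_congr rfl fun s' _ => ?_
    rw [hJs, lsCrossBond_comm]
  rw [hsplit, hcross, hLL, hRR, hX]
  have hmid : (∑ s : torusLeftHalf L j a, ∑ s' : torusLeftHalf L j a,
      ((J s (Torus.reflectBetweenSites j a s') / 2 : ℝ) : ℂ) • lsCrossBond n (s : TorusSite d L) (Torus.reflectBetweenSites j a s')) +
        ∑ s : torusLeftHalf L j a, ∑ s' : torusLeftHalf L j a,
      ((J s (Torus.reflectBetweenSites j a s') / 2 : ℝ) : ℂ) • lsCrossBond n (s : TorusSite d L) (Torus.reflectBetweenSites j a s') =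
      -∑ s : torusLeftHalf L j a, ∑ s' : torusLeftHalf L j a,
        ((J s (Torus.reflectBetweenSites j a s') : ℝ) : ℂ) • ∑ α : Fin 3,
          torusLeftEmbed L j a hL (lsRealSpin n s α) * torusRightEmbed L j a hL (lsRealSpin n s' α) := by
    rw [← Finset.sum_add_distrib, ← Finset.sum_neg_distrib]
    refine sum_congr rfl fun s _ => ?_
    rw [← Finset.sum_add_distrib, ← Finset.sum_neg_distrib]
    refine sum_congr rfl fun s' _ => ?_
    rw [← add_smul, lsCrossBond_eq_sum_embed L j a n hL, smul_neg]
    congr 2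
    push_cast
    ring
  rw [show ∀ P Q R : Op (TorusSite d L) (n + 1), P + Q + (Q + R) = P + R + (Q + Q) from
    fun P Q R => by abel, hmid, sub_eq_add_neg]

/-! #### Reindexing helpers -/

/-- `(X ⊗ 1 + 1 ⊗ Y)` in the tensor-square identification is `(X ⊗ 1) + (1 ⊗ Y)` as a torus
operator. [folklore] -/
private theorem submatrix_kronAdd_eq_embed (hL : Even L) (X Y : Op (torusLeftHalf L j a) (n + 1)) :
    (X ⊗ₖ (1 : Op (torusLeftHalf L j a) (n + 1)) +
        (1 : Op (torusLeftHalf L j a) (n + 1)) ⊗ₖ Y).submatrix (torusSplit L j a hL) (torusSplit L j a hL) =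
      torusLeftEmbed L j a hL X + torusRightEmbed L j a hL Y := by
  rw [torusLeftEmbed_apply, torusRightEmbed_apply]; rfl

/-- `(X ⊗ 1 - 1 ⊗ Y)` in the tensor-square identification is `(X ⊗ 1) - (1 ⊗ Y)` as a torus
operator. [folklore] -/
private theorem submatrix_kronSub_eq_embed (hL : Even L) (X Y : Op (torusLeftHalf L j a) (n + 1)) :
    (X ⊗ₖ (1 : Op (torusLeftHalf L j a) (n + 1)) -
        (1 : Op (torusLeftHalf L j a) (n + 1)) ⊗ₖ Y).submatrix (torusSplit L j a hL) (torusSplit L j a hL) =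
      torusLeftEmbed L j a hL X - torusRightEmbed L j a hL Y := by
  rw [torusLeftEmbed_apply, torusRightEmbed_apply]; rfl

/-! ### §5. Transport of ground states and expectations -/

section Transport

variable {N N' : Type*} [Fintype N] [DecidableEq N] [Fintype N'] [DecidableEq N']

omit [Fintype N] [DecidableEq N] [Fintype N'] [DecidableEq N'] in
/-- Pointwise form of `Matrix.submatrix_sub`. [folklore] -/
private theorem submatrix_sub_apply' (A B : Matrix N N ℂ) (r c : N' → N) :
    (A - B).submatrix r c = A.submatrix r c - B.submatrix r c := rfl

omit [Fintype N] [DecidableEq N] [Fintype N'] [DecidableEq N'] in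
/-- Pointwise form of `Matrix.submatrix_smul`. [folklore] -/
private theorem submatrix_smul_apply' (x : ℂ) (A : Matrix N N ℂ) (r c : N' → N) :
    (x • A).submatrix r c = x • A.submatrix r c := rfl

omit [Fintype N'] [DecidableEq N'] in
/-- Expectations are invariant under a unitary change of frame:
`⟨Wψ, (W O Wᴴ)(Wψ)⟩ = ⟨ψ, Oψ⟩` for `WᴴW = 1`. [folklore] -/
private theorem ls_expect_conj_unitary {W : Matrix N N ℂ} (O : Matrix N N ℂ) (hW' : Wᴴ * W = 1) (ψ : N → ℂ) :
    star (W *ᵥ ψ) ⬝ᵥ ((W * O * Wᴴ) *ᵥ (W *ᵥ ψ)) = star ψ ⬝ᵥ (O *ᵥ ψ) := by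
  rw [mulVec_mulVec, Matrix.mul_assoc, hW', Matrix.mul_one, ← mulVec_mulVec,
    dotProduct_mulVec, star_mulVec, vecMul_vecMul, hW', vecMul_one]

omit [DecidableEq N] [DecidableEq N'] in
/-- Expectations of a reindexed operator: `⟨φ, (D∘(e×e)) φ⟩ = ⟨φ ∘ e⁻¹, D (φ ∘ e⁻¹)⟩`.
[folklore] -/
private theorem ls_expect_submatrix_equiv (D : Matrix N N ℂ) (e : N' ≃ N) (φ : N' → ℂ) :
    star φ ⬝ᵥ ((D.submatrix e e) *ᵥ φ) = star (φ ∘ e.symm) ⬝ᵥ (D *ᵥ (φ ∘ e.symm)) := by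
  rw [submatrix_mulVec_equiv]
  have h : star φ ⬝ᵥ ((D *ᵥ (φ ∘ e.symm)) ∘ e) =
      star ((φ ∘ e.symm) ∘ e) ⬝ᵥ ((D *ᵥ (φ ∘ e.symm)) ∘ e) := by
    rw [Function.comp_assoc, Equiv.symm_comp_self, Function.comp_id]
  rw [h, star_comp_dotProduct_comp]

omit [DecidableEq N] [Fintype N'] [DecidableEq N'] in
/-- A matrix conjugate (by a unitary and a bijection of the bases) to a Hermitian matrix is
Hermitian. [folklore] -/
private theorem ls_isHermitian_of_conj {W H : Matrix N N ℂ} {K : Matrix N' N' ℂ} (hH : H.IsHermitian)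
    (e : N ≃ N') (hrot : W * H * Wᴴ = K.submatrix e e) : K.IsHermitian := by
  have h1 : (W * H * Wᴴ).IsHermitian := by
    rw [IsHermitian, conjTranspose_mul, conjTranspose_mul, conjTranspose_conjTranspose, hH.eq,
      Matrix.mul_assoc]
  have h2 : K = (W * H * Wᴴ).submatrix e.symm e.symm := by
    rw [hrot, submatrix_submatrix, Equiv.self_comp_symm, submatrix_id_id]
  rw [h2]
  exact h1.submatrix _

/-- The ground energy is invariant under the change of frame. [folklore] -/
private theorem ls_groundEnergy_eq_of_conj [Nonempty N] {W H : Matrix N N ℂ} {K : Matrix N' N' ℂ}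
    (hH : H.IsHermitian) (hW : W * Wᴴ = 1) (e : N ≃ N') (hrot : W * H * Wᴴ = K.submatrix e e) :
    K.groundEnergy = H.groundEnergy := by
  haveI : Nonempty N' := Nonempty.map e inferInstance
  have hK : K.IsHermitian := ls_isHermitian_of_conj hH e hrot
  rw [← groundEnergy_submatrix_equiv hK e, ← hrot,
    groundEnergy_unitary_conj (Matrix.mem_unitaryGroup_iff.2 (by rw [star_eq_conjTranspose]; exact hW))]

/-- **Transport of ground states to the rotated frame**: if `W H Wᴴ = K ∘ (e × e)` then
`(Wψ) ∘ e⁻¹` is a ground-state vector of `K` for every ground-state vector `ψ` of `H`. [folklore] -/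
private theorem ls_mem_groundSpace_of_conj [Nonempty N] {W H : Matrix N N ℂ} {K : Matrix N' N' ℂ}
    (hH : H.IsHermitian) (hW : W * Wᴴ = 1) (hW' : Wᴴ * W = 1) (e : N ≃ N')
    (hrot : W * H * Wᴴ = K.submatrix e e) {ψ : N → ℂ} (hψ : ψ ∈ H.groundSpace) :
    (W *ᵥ ψ) ∘ e.symm ∈ K.groundSpace := by
  rw [mem_groundSpace_iff, ls_groundEnergy_eq_of_conj hH hW e hrot]
  have h1 : (K.submatrix e e) *ᵥ (W *ᵥ ψ) = (H.groundEnergy : ℂ) • (W *ᵥ ψ) := by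
    rw [← hrot, mulVec_mulVec, Matrix.mul_assoc, hW', Matrix.mul_one, ← mulVec_mulVec,
      (mem_groundSpace_iff H ψ).1 hψ, mulVec_smul]
  rw [submatrix_mulVec_equiv] at h1
  have h2 := congrArg (fun f => f ∘ e.symm) h1
  simp only [Function.comp_assoc, Equiv.self_comp_symm, Function.comp_id] at h2
  rw [h2]
  rfl

/-- **Transport of ground states from the rotated frame**: `Wᴴ (φ ∘ e)` is a ground-state vector of
`H` for every ground-state vector `φ` of `K`, and it is non-zero if `φ` is. [folklore] -/
private theorem ls_mem_groundSpace_of_conj' [Nonempty N] {W H : Matrix N N ℂ} {K : Matrix N' N' ℂ}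
    (hH : H.IsHermitian) (hW : W * Wᴴ = 1) (hW' : Wᴴ * W = 1) (e : N ≃ N')
    (hrot : W * H * Wᴴ = K.submatrix e e) {φ : N' → ℂ} (hφ : φ ∈ K.groundSpace) :
    Wᴴ *ᵥ (φ ∘ e) ∈ H.groundSpace ∧ (φ ≠ 0 → Wᴴ *ᵥ (φ ∘ e) ≠ 0) := by
  have hHK : H = Wᴴ * K.submatrix e e * W := by
    rw [← hrot, Matrix.mul_assoc, Matrix.mul_assoc, hW', Matrix.mul_one, ← Matrix.mul_assoc,
      hW', Matrix.one_mul]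
  refine ⟨?_, fun hφ0 h0 => hφ0 ?_⟩
  · rw [mem_groundSpace_iff, ← ls_groundEnergy_eq_of_conj hH hW e hrot, hHK, mulVec_mulVec,
      Matrix.mul_assoc, hW, Matrix.mul_one, ← mulVec_mulVec, submatrix_mulVec_equiv]
    have h3 : (φ ∘ e) ∘ e.symm = φ := by
      rw [Function.comp_assoc, Equiv.self_comp_symm, Function.comp_id]
    rw [h3, (mem_groundSpace_iff K φ).1 hφ]
    rw [show ((K.groundEnergy : ℂ) • φ) ∘ e = (K.groundEnergy : ℂ) • (φ ∘ e) from rfl, mulVec_smul]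
  · have h1 : W *ᵥ (Wᴴ *ᵥ (φ ∘ e)) = 0 := by rw [h0, mulVec_zero]
    rw [mulVec_mulVec, hW, one_mulVec] at h1
    funext i
    have := congrFun h1 (e.symm i)
    simpa using this

end Transport

/-! ### §6. The theorems of Lieb–Schupp for `H_J` -/

section Main

variable {J : TorusSite d L → TorusSite d L → ℝ} {κ : Type*} [Fintype κ]

/-- `W H_J Wᴴ` is the rotated Hamiltonian. [cite: LiebSchupp1999, p. 2, eq. (ev)] -/
theorem conj_pairHeisenberg_eq_rot {W : Op (TorusSite d L) (n + 1)} (hW' : Wᴴ * W = 1)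
    (hWS : ∀ (x : TorusSite d L) (α : Fin 3), W * siteSpin n x α * Wᴴ = rhSign L j a x α • siteSpin n x α)
    (J : TorusSite d L → TorusSite d L → ℝ) :
    W * pairHeisenberg n J * Wᴴ = pairHeisenbergRot L j a n J := by
  rw [pairHeisenberg, pairHeisenbergRot, Finset.mul_sum, Finset.sum_mul]
  refine sum_congr rfl fun x _ => ?_
  rw [Finset.mul_sum, Finset.sum_mul]
  refine sum_congr rfl fun y _ => ?_
  rw [Matrix.mul_smul, Matrix.smul_mul]
  congr 1
  by_cases hxy : (x ∈ torusLeftHalf L j a ↔ y ∈ torusLeftHalf L j a)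
  · rw [if_pos hxy, conj_spinDot_of_same hW' hWS hxy]
  · rw [if_neg hxy, conj_spinDot_of_cross hW' hWS hxy]

/-- **The Lieb–Schupp frame**: the right-half rotation `W` together with the Kronecker form
`W H_J Wᴴ = (H_L ⊗ 1 + 1 ⊗ H_L - Σ_{k,α} M_{kα} ⊗ M_{kα}) ∘ (split × split)`.
[cite: LiebSchupp2000, §2] [cite: LiebSchupp1999, eq. (ev)] -/
theorem exists_liebSchuppFrame (hL : Even L) (hJs : ∀ x y, J x y = J y x)
    (hJθ : ∀ x y, J (Torus.reflectBetweenSites j a x) (Torus.reflectBetweenSites j a y) = J x y)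
    (v : κ → TorusSite d L → ℝ)
    (hC : ∀ s ∈ torusLeftHalf L j a, ∀ s' ∈ torusLeftHalf L j a,
      J s (Torus.reflectBetweenSites j a s') = ∑ k, v k s * v k s') :
    ∃ W : Op (TorusSite d L) (n + 1), W * Wᴴ = 1 ∧ Wᴴ * W = 1 ∧
      (∀ (x : TorusSite d L) (α : Fin 3), W * siteSpin n x α * Wᴴ = rhSign L j a x α • siteSpin n x α) ∧
      W * pairHeisenberg n J * Wᴴ =
        (lsLeftHamiltonian L j a n J ⊗ₖ (1 : Op (torusLeftHalf L j a) (n + 1)) +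
          (1 : Op (torusLeftHalf L j a) (n + 1)) ⊗ₖ lsLeftHamiltonian L j a n J -
          ∑ kα : κ × Fin 3, lsCrossOp L j a n v kα ⊗ₖ lsCrossOp L j a n v kα).submatrix
          (torusSplit L j a hL) (torusSplit L j a hL) := by
  obtain ⟨W, hW, hW', hWS⟩ := exists_rightHalfRotation L j a n
  exact ⟨W, hW, hW', hWS, by
    rw [conj_pairHeisenberg_eq_rot hW' hWS, pairHeisenbergRot_eq_submatrix hL hJs hJθ v hC]⟩

/-- The rotated total spin: `W S^α_tot Wᴴ = (S^α_L ⊗ 1 + 1 ⊗ (±S^α_L))` with sign `+` for the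
`2`-component and `-` otherwise. [cite: LiebSchupp2000, §5] -/
theorem conj_totalSpin_eq_submatrix (hL : Even L) {W : Op (TorusSite d L) (n + 1)}
    (hWS : ∀ (x : TorusSite d L) (α : Fin 3), W * siteSpin n x α * Wᴴ = rhSign L j a x α • siteSpin n x α)
    (α : Fin 3) :
    W * totalSpin n α * Wᴴ =
      (totalSpin n α ⊗ₖ (1 : Op (torusLeftHalf L j a) (n + 1)) +
        (1 : Op (torusLeftHalf L j a) (n + 1)) ⊗ₖ
          ((if α = 1 then (1 : ℂ) else -1) • totalSpin n α)).submatrix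
        (torusSplit L j a hL) (torusSplit L j a hL) := by
  have hmemθ : ∀ s : torusLeftHalf L j a,
      Torus.reflectBetweenSites j a (s : TorusSite d L) ∉ torusLeftHalf L j a := fun s h =>
    (reflectBetweenSites_mem_torusLeftHalf_iff L j a hL (s : TorusSite d L)).1 h s.2
  rw [submatrix_kronAdd_eq_embed]
  simp only [totalSpin]
  rw [Finset.mul_sum, Finset.sum_mul, sum_torus_eq_sum_half L j a hL, map_sum, map_smul, map_sum,
    Finset.smul_sum]
  congr 1
  · refine sum_congr rfl fun s _ => ?_
    rw [hWS, rhSign_of_mem L j a s.2, one_smul, torusLeftEmbed_siteSpin]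
  · refine sum_congr rfl fun s _ => ?_
    rw [hWS, torusRightEmbed_siteSpin]
    by_cases hα : α = 1
    · rw [hα, rhSign_one, if_pos rfl]
    · rw [rhSign_of_not_mem L j a (hmemθ s) hα, if_neg hα]

/-- `(±S^α_L)ᵀ = -S^α_L`: the rotated copies are minus the transposes (`S¹`, `S³` real symmetric,
`S²` imaginary antisymmetric). [folklore] -/
private theorem totalSpin_rot_transpose (α : Fin 3) :
    ((if α = 1 then (1 : ℂ) else -1) • (totalSpin n α : Op (torusLeftHalf L j a) (n + 1)))ᵀ =
      -totalSpin n α := by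
  rw [transpose_smul, totalSpin, transpose_sum]
  by_cases hα : α = 1
  · subst hα
    rw [if_pos rfl, one_smul, ← Finset.sum_neg_distrib]
    exact sum_congr rfl fun s _ => siteSpin_one_transpose n s
  · rw [if_neg hα, neg_one_smul]
    exact congrArg Neg.neg (sum_congr rfl fun s _ => siteSpin_transpose_of_ne_one n s hα)

omit [Fintype κ] in
/-- The ice operator in the rotated frame is `M_{kα} ⊗ 1 - 1 ⊗ M_{kα}` (`α ≠ 1`).
[cite: LiebSchupp2000, §7] -/
theorem conj_lsIceOp_eq_submatrix (hL : Even L) {W : Op (TorusSite d L) (n + 1)}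
    (hWS : ∀ (x : TorusSite d L) (α : Fin 3), W * siteSpin n x α * Wᴴ = rhSign L j a x α • siteSpin n x α)
    (v : κ → TorusSite d L → ℝ) (k : κ) {α : Fin 3} (hα : α ≠ 1) :
    W * lsIceOp L j a n v k α * Wᴴ =
      (lsCrossOp L j a n v (k, α) ⊗ₖ (1 : Op (torusLeftHalf L j a) (n + 1)) -
        (1 : Op (torusLeftHalf L j a) (n + 1)) ⊗ₖ lsCrossOp L j a n v (k, α)).submatrix
        (torusSplit L j a hL) (torusSplit L j a hL) := by
  rw [conj_lsIceOp_of_ne_one hL hWS v k hα, submatrix_kronSub_eq_embed, lsCrossOp, map_sum, map_sum,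
    ← Finset.sum_sub_distrib, ← Finset.sum_coe_sort (torusLeftHalf L j a)]
  refine sum_congr rfl fun s _ => ?_
  rw [map_smul, map_smul, lsRealSpin_of_ne_one n s hα, torusLeftEmbed_siteSpin, torusRightEmbed_siteSpin,
    smul_sub]

/-- **A ground state with total spin zero exists** ([LiebSchupp2000] §5, last paragraph: "a
reflection symmetric spin system always has a ground state with total spin zero … provided that
total spin is a good quantum number"; [LiebSchupp1999] p. 3): for every symmetric, reflection-
invariant coupling `J` on the even torus whose crossing couplings are a sum of squares
(`J(s, θs') = Σ_k v_k(s)v_k(s')`, i.e. antiferromagnetic bonds between sets of sites), the pair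
Heisenberg Hamiltonian `H_J` has a non-zero ground-state vector `ψ` with `S^α_tot ψ = 0`,
`α = 1, 2, 3`. [cite: LiebSchupp2000, §5] [cite: LiebSchupp1999, p. 3] -/
theorem pairHeisenberg_exists_singlet_groundState (hL : Even L) (hJs : ∀ x y, J x y = J y x)
    (hJθ : ∀ x y, J (Torus.reflectBetweenSites j a x) (Torus.reflectBetweenSites j a y) = J x y)
    (v : κ → TorusSite d L → ℝ)
    (hC : ∀ s ∈ torusLeftHalf L j a, ∀ s' ∈ torusLeftHalf L j a,
      J s (Torus.reflectBetweenSites j a s') = ∑ k, v k s * v k s') :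
    ∃ ψ ∈ (pairHeisenberg n J).groundSpace, ψ ≠ 0 ∧ ∀ α : Fin 3, totalSpin n α *ᵥ ψ = 0 := by
  classical
  obtain ⟨W, hW, hW', hWS, hrot⟩ := exists_liebSchuppFrame (n := n) hL hJs hJθ v hC
  have hH : (pairHeisenberg n J).IsHermitian := pairHeisenberg_isHermitian n J
  have hK := ls_isHermitian_of_conj hH _ hrot
  -- the rotated charges `S^α_L ⊗ 1 + 1 ⊗ (±S^α_L)`
  have hXY : ∀ α : Fin 3,
      ((if α = 1 then (1 : ℂ) else -1) • (totalSpin n α : Op (torusLeftHalf L j a) (n + 1)))ᵀ =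
        -totalSpin n α := fun α => totalSpin_rot_transpose α
  have hQ : ∀ α : Fin 3, W * totalSpin n α * Wᴴ =
      (totalSpin n α ⊗ₖ (1 : Op (torusLeftHalf L j a) (n + 1)) +
        (1 : Op (torusLeftHalf L j a) (n + 1)) ⊗ₖ
          ((if α = 1 then (1 : ℂ) else -1) • totalSpin n α)).submatrix
        (torusSplit L j a hL) (torusSplit L j a hL) := fun α => conj_totalSpin_eq_submatrix hL hWS α
  have hcomm : ∀ α : Fin 3,
      (totalSpin n α ⊗ₖ (1 : Op (torusLeftHalf L j a) (n + 1)) +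
        (1 : Op (torusLeftHalf L j a) (n + 1)) ⊗ₖ ((if α = 1 then (1 : ℂ) else -1) • totalSpin n α)) *
        (lsLeftHamiltonian L j a n J ⊗ₖ (1 : Op (torusLeftHalf L j a) (n + 1)) +
          (1 : Op (torusLeftHalf L j a) (n + 1)) ⊗ₖ lsLeftHamiltonian L j a n J -
          ∑ kα : κ × Fin 3, lsCrossOp L j a n v kα ⊗ₖ lsCrossOp L j a n v kα) =
      (lsLeftHamiltonian L j a n J ⊗ₖ (1 : Op (torusLeftHalf L j a) (n + 1)) +
          (1 : Op (torusLeftHalf L j a) (n + 1)) ⊗ₖ lsLeftHamiltonian L j a n J -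
          ∑ kα : κ × Fin 3, lsCrossOp L j a n v kα ⊗ₖ lsCrossOp L j a n v kα) *
        (totalSpin n α ⊗ₖ (1 : Op (torusLeftHalf L j a) (n + 1)) +
          (1 : Op (torusLeftHalf L j a) (n + 1)) ⊗ₖ ((if α = 1 then (1 : ℂ) else -1) • totalSpin n α)) := by
    intro α
    have h1 : (W * totalSpin n α * Wᴴ) * (W * pairHeisenberg n J * Wᴴ) =
        (W * pairHeisenberg n J * Wᴴ) * (W * totalSpin n α * Wᴴ) := by
      rw [← conj_mul_of_unitary hW', ← conj_mul_of_unitary hW', (commute_pairHeisenberg_totalSpin n J α).eq]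
    rw [hQ, hrot, submatrix_mul_equiv, submatrix_mul_equiv] at h1
    have h2 := congrArg (fun Z => Matrix.submatrix Z (torusSplit L j a hL).symm (torusSplit L j a hL).symm) h1
    simpa only [submatrix_submatrix, Equiv.self_comp_symm, submatrix_id_id] using h2
  obtain ⟨φ, hφ, hφ0, hQφ⟩ := Matrix.liebSchupp_exists_groundState_annihilated
    (lsLeftHamiltonian L j a n J) (lsCrossOp L j a n v) (lsLeftHamiltonian_transpose J)
    (fun kα => lsCrossOp_transpose_eq v kα) hK (fun α => totalSpin n α)
    (fun α => (if α = 1 then (1 : ℂ) else -1) • totalSpin n α) hXY hcomm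
  obtain ⟨hψ, hψ0⟩ := ls_mem_groundSpace_of_conj' hH hW hW' _ hrot hφ
  refine ⟨Wᴴ *ᵥ (φ ∘ torusSplit L j a hL), hψ, hψ0 hφ0, fun α => ?_⟩
  have h1 : totalSpin n α * Wᴴ = Wᴴ * (W * totalSpin n α * Wᴴ) := by
    rw [← Matrix.mul_assoc, ← Matrix.mul_assoc, hW', Matrix.one_mul]
  rw [mulVec_mulVec, h1, ← mulVec_mulVec, hQ, submatrix_mulVec_equiv]
  have h3 : (φ ∘ torusSplit L j a hL) ∘ (torusSplit L j a hL).symm = φ := by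
    rw [Function.comp_assoc, Equiv.self_comp_symm, Function.comp_id]
  rw [h3, hQφ, Pi.zero_comp, mulVec_zero]

/-- **The quantum ice rule, components `1` and `3`** ([LiebSchupp2000] §7 eq. (ice): "the
expectation of the third spin component of the sites involved in each crossing bond `B`, weighted
by their coefficients `jᵢ`, vanishes for any ground state … By symmetry (ice) will also be true for
the first spin component"; [LiebSchupp1999] p. 4): for EVERY ground-state vector `ψ` of `H_J`,
every crossing unit `k` and `α ≠ 1` (the two components reversed by the rotation),
`⟨ψ, Σ_s v_k(s)(S^α_s + S^α_{θs}) ψ⟩ = 0`. [cite: LiebSchupp2000, §7] [cite: LiebSchupp1999, p. 4] -/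
theorem pairHeisenberg_iceRule_of_ne_one (hL : Even L) (hJs : ∀ x y, J x y = J y x)
    (hJθ : ∀ x y, J (Torus.reflectBetweenSites j a x) (Torus.reflectBetweenSites j a y) = J x y)
    (v : κ → TorusSite d L → ℝ)
    (hC : ∀ s ∈ torusLeftHalf L j a, ∀ s' ∈ torusLeftHalf L j a,
      J s (Torus.reflectBetweenSites j a s') = ∑ k, v k s * v k s')
    (k : κ) {α : Fin 3} (hα : α ≠ 1) {ψ : TensorIndex (TorusSite d L) (n + 1) → ℂ}
    (hψ : ψ ∈ (pairHeisenberg n J).groundSpace) :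
    star ψ ⬝ᵥ (lsIceOp L j a n v k α *ᵥ ψ) = 0 := by
  classical
  obtain ⟨W, hW, hW', hWS, hrot⟩ := exists_liebSchuppFrame (n := n) hL hJs hJθ v hC
  have hH : (pairHeisenberg n J).IsHermitian := pairHeisenberg_isHermitian n J
  have hK := ls_isHermitian_of_conj hH _ hrot
  have hφ := ls_mem_groundSpace_of_conj hH hW hW' _ hrot hψ
  have hice := Matrix.liebSchupp_iceRule (lsLeftHamiltonian L j a n J) (lsCrossOp L j a n v)
    (lsLeftHamiltonian_transpose J) (fun kα => lsCrossOp_transpose_eq v kα) (k, α)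
    (lsCrossOp_transpose_of_ne_one v k hα) hK hφ
  rw [← ls_expect_conj_unitary (lsIceOp L j a n v k α) hW' ψ, conj_lsIceOp_eq_submatrix hL hWS v k hα,
    ls_expect_submatrix_equiv]
  exact hice

/-- **The global quarter turn about the `3`-axis** (`S¹ ↦ -S²`, `S² ↦ S¹`, `S³ ↦ S³` on every
site), used to carry the ice rule over to the `2`-component ([LiebSchupp2000] §7: "if we are
dealing with a spin Hamiltonian that is invariant under spin rotations, it is also true for the
second spin component"). [cite: LiebSchupp2000, §7] -/
theorem exists_quarterTurn :
    ∃ U : Op (TorusSite d L) (n + 1), U * Uᴴ = 1 ∧ Uᴴ * U = 1 ∧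
      (∀ x : TorusSite d L, U * siteSpin n x 0 * Uᴴ = -siteSpin n x 1) ∧
      (∀ x : TorusSite d L, U * siteSpin n x 1 * Uᴴ = siteSpin n x 0) ∧
      (∀ x : TorusSite d L, U * siteSpin n x 2 * Uᴴ = siteSpin n x 2) := by
  obtain ⟨D, hD, hD', hDx, hDy, hDz⟩ := exists_unitary_conj_spinX_eq_neg_spinY n
  refine ⟨productOp fun _ => D, productOp_mul_conjTranspose fun _ => hD,
    productOp_conjTranspose_mul fun _ => hD', fun x => ?_, fun x => ?_, fun x => ?_⟩
  · rw [productOp_conj_siteSpin (fun _ => hD), spinVec_zero, hDx, onSite_neg', siteSpin, spinVec_one]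
  · rw [productOp_conj_siteSpin (fun _ => hD), spinVec_one, hDy, siteSpin, spinVec_zero]
  · rw [productOp_conj_siteSpin (fun _ => hD), spinVec_two, hDz, siteSpin, spinVec_two]

/-- Under the quarter turn `𝐒_x·𝐒_y` is invariant (`SU(2)`-invariance of the exchange bond).
[folklore] -/
private theorem conj_spinDot_quarterTurn {U : Op (TorusSite d L) (n + 1)} (hU' : Uᴴ * U = 1)
    (h0 : ∀ x : TorusSite d L, U * siteSpin n x 0 * Uᴴ = -siteSpin n x 1)
    (h1 : ∀ x : TorusSite d L, U * siteSpin n x 1 * Uᴴ = siteSpin n x 0)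
    (h2 : ∀ x : TorusSite d L, U * siteSpin n x 2 * Uᴴ = siteSpin n x 2) (x y : TorusSite d L) :
    U * spinDot n x y * Uᴴ = spinDot n x y := by
  have hb : ∀ (α β : Fin 3) (ε : ℂ), ε * ε = 1 →
      (∀ z : TorusSite d L, U * siteSpin n z α * Uᴴ = ε • siteSpin n z β) →
      U * spinBond n α x y * Uᴴ = spinBond n β x y := by
    intro α β ε hε h
    rw [spinBond, spinBond, Matrix.mul_smul, Matrix.smul_mul, Matrix.mul_add, Matrix.add_mul,
      conj_mul_of_unitary hU', conj_mul_of_unitary hU', h, h, smul_mul_smul_comm, smul_mul_smul_comm, hε,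
      one_smul, one_smul]
  rw [spinDot, Finset.mul_sum, Finset.sum_mul, Fin.sum_univ_three, Fin.sum_univ_three,
    hb 0 1 (-1) (by norm_num) (fun z => by rw [h0, neg_one_smul]),
    hb 1 0 1 (one_mul 1) (fun z => by rw [h1, one_smul]),
    hb 2 2 1 (one_mul 1) (fun z => by rw [h2, one_smul])]
  abel

/-- `H_J` is invariant under the quarter turn. [cite: LiebSchupp2000, §7] -/
theorem conj_pairHeisenberg_quarterTurn {U : Op (TorusSite d L) (n + 1)} (hU' : Uᴴ * U = 1)
    (h0 : ∀ x : TorusSite d L, U * siteSpin n x 0 * Uᴴ = -siteSpin n x 1)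
    (h1 : ∀ x : TorusSite d L, U * siteSpin n x 1 * Uᴴ = siteSpin n x 0)
    (h2 : ∀ x : TorusSite d L, U * siteSpin n x 2 * Uᴴ = siteSpin n x 2)
    (J : TorusSite d L → TorusSite d L → ℝ) :
    U * pairHeisenberg n J * Uᴴ = pairHeisenberg n J := by
  rw [pairHeisenberg, Finset.mul_sum, Finset.sum_mul]
  refine sum_congr rfl fun x _ => ?_
  rw [Finset.mul_sum, Finset.sum_mul]
  refine sum_congr rfl fun y _ => ?_
  rw [Matrix.mul_smul, Matrix.smul_mul, conj_spinDot_quarterTurn hU' h0 h1 h2]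

omit [Fintype κ] in
/-- The quarter turn maps the ice operator of the `2`-component to that of the `1`-component.
[cite: LiebSchupp2000, §7] -/
theorem conj_lsIceOp_one_quarterTurn {U : Op (TorusSite d L) (n + 1)}
    (h1 : ∀ x : TorusSite d L, U * siteSpin n x 1 * Uᴴ = siteSpin n x 0)
    (v : κ → TorusSite d L → ℝ) (k : κ) :
    U * lsIceOp L j a n v k 1 * Uᴴ = lsIceOp L j a n v k 0 := by
  rw [lsIceOp, lsIceOp, Finset.mul_sum, Finset.sum_mul]
  refine sum_congr rfl fun s _ => ?_
  rw [Matrix.mul_smul, Matrix.smul_mul, Matrix.mul_add, Matrix.add_mul, h1, h1]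

/-- **The quantum ice rule, all three components** ([LiebSchupp1999] p. 4: "This quantum analog
of the 'ice rule' is true for any box on the symmetry line and it holds for all three spin
components"; [LiebSchupp2000] §7): for every ground-state vector `ψ` of `H_J`, every crossing unit
`k` and every component `α`, `⟨ψ, Σ_s v_k(s)(S^α_s + S^α_{θs}) ψ⟩ = 0`.
[cite: LiebSchupp1999, p. 4] [cite: LiebSchupp2000, §7] -/
theorem pairHeisenberg_iceRule (hL : Even L) (hJs : ∀ x y, J x y = J y x)
    (hJθ : ∀ x y, J (Torus.reflectBetweenSites j a x) (Torus.reflectBetweenSites j a y) = J x y)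
    (v : κ → TorusSite d L → ℝ)
    (hC : ∀ s ∈ torusLeftHalf L j a, ∀ s' ∈ torusLeftHalf L j a,
      J s (Torus.reflectBetweenSites j a s') = ∑ k, v k s * v k s')
    (k : κ) (α : Fin 3) {ψ : TensorIndex (TorusSite d L) (n + 1) → ℂ}
    (hψ : ψ ∈ (pairHeisenberg n J).groundSpace) :
    star ψ ⬝ᵥ (lsIceOp L j a n v k α *ᵥ ψ) = 0 := by
  by_cases hα : α ≠ 1
  · exact pairHeisenberg_iceRule_of_ne_one hL hJs hJθ v hC k hα hψ
  obtain rfl := not_ne_iff.1 hα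
  obtain ⟨U, -, hU', h0, h1, h2⟩ := exists_quarterTurn (L := L) (n := n) (d := d)
  have hHU : U * pairHeisenberg n J = pairHeisenberg n J * U := by
    conv_rhs => rw [← conj_pairHeisenberg_quarterTurn hU' h0 h1 h2 J]
    rw [Matrix.mul_assoc, hU', Matrix.mul_one]
  have hUψ : U *ᵥ ψ ∈ (pairHeisenberg n J).groundSpace := mulVec_mem_groundSpace_of_commute hHU hψ
  rw [← ls_expect_conj_unitary (lsIceOp L j a n v k 1) hU' ψ, conj_lsIceOp_one_quarterTurn h1 v k]
  exact pairHeisenberg_iceRule_of_ne_one hL hJs hJθ v hC k (α := 0) (by decide) hUψ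

/-- **The field inequality `E_b ≥ E_0`** ([LiebSchupp2000] §7: "`H(b) ≡ H - b(S_B + S_{B'}) + b²/2`
… One can show that `E_b ≥ E_0`"; [LiebSchupp1999] p. 4, whence the susceptibility bound
`χ_box ≤ 1/4`): for a field `b` coupled to one crossing unit in a component `α ≠ 1`,
`E₀(H_J - b Σ_s v_k(s)(S^α_s + S^α_{θs})) ≥ E₀(H_J) - b²/2`. (The `2`-component follows by the
quarter turn; not restated.) [cite: LiebSchupp2000, §7] [cite: LiebSchupp1999, p. 4] -/
theorem pairHeisenberg_groundEnergy_sub_field_ge (hL : Even L) (hJs : ∀ x y, J x y = J y x)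
    (hJθ : ∀ x y, J (Torus.reflectBetweenSites j a x) (Torus.reflectBetweenSites j a y) = J x y)
    (v : κ → TorusSite d L → ℝ)
    (hC : ∀ s ∈ torusLeftHalf L j a, ∀ s' ∈ torusLeftHalf L j a,
      J s (Torus.reflectBetweenSites j a s') = ∑ k, v k s * v k s')
    (k : κ) {α : Fin 3} (hα : α ≠ 1) (b : ℝ) :
    (pairHeisenberg n J).groundEnergy - b ^ 2 / 2 ≤
      (pairHeisenberg n J - (b : ℂ) • lsIceOp L j a n v k α).groundEnergy := by
  classical
  obtain ⟨W, hW, hW', hWS, hrot⟩ := exists_liebSchuppFrame (n := n) hL hJs hJθ v hC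
  have hH : (pairHeisenberg n J).IsHermitian := pairHeisenberg_isHermitian n J
  have hHb : (pairHeisenberg n J - (b : ℂ) • lsIceOp L j a n v k α).IsHermitian :=
    hH.sub ((lsIceOp_isHermitian v k α).ofReal_smul b)
  have hK := ls_isHermitian_of_conj hH _ hrot
  have hrot' : W * (pairHeisenberg n J - (b : ℂ) • lsIceOp L j a n v k α) * Wᴴ =
      (lsLeftHamiltonian L j a n J ⊗ₖ (1 : Op (torusLeftHalf L j a) (n + 1)) +
          (1 : Op (torusLeftHalf L j a) (n + 1)) ⊗ₖ lsLeftHamiltonian L j a n J -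
          ∑ kα : κ × Fin 3, lsCrossOp L j a n v kα ⊗ₖ lsCrossOp L j a n v kα -
        (b : ℂ) • (lsCrossOp L j a n v (k, α) ⊗ₖ (1 : Op (torusLeftHalf L j a) (n + 1)) -
          (1 : Op (torusLeftHalf L j a) (n + 1)) ⊗ₖ lsCrossOp L j a n v (k, α))).submatrix
        (torusSplit L j a hL) (torusSplit L j a hL) := by
    conv_rhs => rw [submatrix_sub_apply', submatrix_smul_apply']
    rw [Matrix.mul_sub, Matrix.sub_mul, Matrix.mul_smul, Matrix.smul_mul, hrot,
      conj_lsIceOp_eq_submatrix hL hWS v k hα]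
  have hE := Matrix.liebSchupp_groundEnergy_sub_field_ge (lsLeftHamiltonian L j a n J) (lsCrossOp L j a n v)
    (lsLeftHamiltonian_transpose J) (fun kα => lsCrossOp_transpose_eq v kα) (k, α)
    (lsCrossOp_transpose_of_ne_one v k hα) hK b
  rw [ls_groundEnergy_eq_of_conj hH hW _ hrot, ls_groundEnergy_eq_of_conj hHb hW _ hrot'] at hE
  exact hE

/-- **The ice rule at positive temperature: `Z_b ≤ Z_0`** ([LiebSchupp1999] p. 4, eq. (ineqz):
"The analog of (ineq) holds also for the partition function … `Z_{b} ≤ Z_0`, as can be shown by a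
straightforward application of lemma 4.1 in section 4 of [DLS]"; here for the field on ONE
crossing unit, `H_b = H_J - b O_{k,α} + b²/2`): for `β ≥ 0` and `α ≠ 1`,
`tr e^{-β(H_J - b O_{k,α})} ≤ e^{β b²/2} tr e^{-β H_J}`. [cite: LiebSchupp1999, p. 4, eq. (ineqz)] -/
theorem pairHeisenberg_partitionFn_sub_field_le (hL : Even L) (hJs : ∀ x y, J x y = J y x)
    (hJθ : ∀ x y, J (Torus.reflectBetweenSites j a x) (Torus.reflectBetweenSites j a y) = J x y)
    (v : κ → TorusSite d L → ℝ)
    (hC : ∀ s ∈ torusLeftHalf L j a, ∀ s' ∈ torusLeftHalf L j a,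
      J s (Torus.reflectBetweenSites j a s') = ∑ k, v k s * v k s')
    (k : κ) {α : Fin 3} (hα : α ≠ 1) {β : ℝ} (hβ : 0 ≤ β) (b : ℝ) :
    (partitionFn β (pairHeisenberg n J - (b : ℂ) • lsIceOp L j a n v k α)).re ≤
      Real.exp (β * b ^ 2 / 2) * (partitionFn β (pairHeisenberg n J)).re := by
  classical
  obtain ⟨W, hW, hW', hWS, hrot⟩ := exists_liebSchuppFrame (n := n) hL hJs hJθ v hC
  have hH : (pairHeisenberg n J).IsHermitian := pairHeisenberg_isHermitian n J
  have hK := ls_isHermitian_of_conj hH _ hrot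
  have hrot' : W * (pairHeisenberg n J - (b : ℂ) • lsIceOp L j a n v k α) * Wᴴ =
      (lsLeftHamiltonian L j a n J ⊗ₖ (1 : Op (torusLeftHalf L j a) (n + 1)) +
          (1 : Op (torusLeftHalf L j a) (n + 1)) ⊗ₖ lsLeftHamiltonian L j a n J -
          ∑ kα : κ × Fin 3, lsCrossOp L j a n v kα ⊗ₖ lsCrossOp L j a n v kα -
        (b : ℂ) • (lsCrossOp L j a n v (k, α) ⊗ₖ (1 : Op (torusLeftHalf L j a) (n + 1)) -
          (1 : Op (torusLeftHalf L j a) (n + 1)) ⊗ₖ lsCrossOp L j a n v (k, α))).submatrix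
        (torusSplit L j a hL) (torusSplit L j a hL) := by
    conv_rhs => rw [submatrix_sub_apply', submatrix_smul_apply']
    rw [Matrix.mul_sub, Matrix.sub_mul, Matrix.mul_smul, Matrix.smul_mul, hrot,
      conj_lsIceOp_eq_submatrix hL hWS v k hα]
  have hZ := Matrix.liebSchupp_partitionFn_sub_field_le (lsLeftHamiltonian L j a n J) (lsCrossOp L j a n v)
    (lsLeftHamiltonian_transpose_eq J) (fun kα => lsCrossOp_transpose_eq v kα) (k, α)
    (lsCrossOp_transpose_of_ne_one v k hα) hK hβ b
  have hU : W ∈ Matrix.unitaryGroup (TensorIndex (TorusSite d L) (n + 1)) ℂ :=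
    Matrix.mem_unitaryGroup_iff.2 (by rw [star_eq_conjTranspose]; exact hW)
  have h1 : partitionFn β (pairHeisenberg n J) =
      partitionFn β (lsLeftHamiltonian L j a n J ⊗ₖ (1 : Op (torusLeftHalf L j a) (n + 1)) +
          (1 : Op (torusLeftHalf L j a) (n + 1)) ⊗ₖ lsLeftHamiltonian L j a n J -
          ∑ kα : κ × Fin 3, lsCrossOp L j a n v kα ⊗ₖ lsCrossOp L j a n v kα) := by
    rw [← Matrix.partitionFn_unitary_conj hU β (pairHeisenberg n J), star_eq_conjTranspose, hrot,
      Matrix.partitionFn_submatrix_equiv]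
  have h2 : partitionFn β (pairHeisenberg n J - (b : ℂ) • lsIceOp L j a n v k α) =
      partitionFn β (lsLeftHamiltonian L j a n J ⊗ₖ (1 : Op (torusLeftHalf L j a) (n + 1)) +
          (1 : Op (torusLeftHalf L j a) (n + 1)) ⊗ₖ lsLeftHamiltonian L j a n J -
          ∑ kα : κ × Fin 3, lsCrossOp L j a n v kα ⊗ₖ lsCrossOp L j a n v kα -
        (b : ℂ) • (lsCrossOp L j a n v (k, α) ⊗ₖ (1 : Op (torusLeftHalf L j a) (n + 1)) -
          (1 : Op (torusLeftHalf L j a) (n + 1)) ⊗ₖ lsCrossOp L j a n v (k, α))) := by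
    rw [← Matrix.partitionFn_unitary_conj hU β (pairHeisenberg n J - (b : ℂ) • lsIceOp L j a n v k α),
      star_eq_conjTranspose, hrot', Matrix.partitionFn_submatrix_equiv]
  rw [h1, h2]
  exact hZ

/-- **All ground states are singlets when the ice rules cover the total spin** ([LiebSchupp1999]
p. 4: "in such a system the magnetization is zero both for every single box separately and also
for the whole system: `⟨0|S³_tot|0⟩ = 0` … this implies that the total spin is zero for all ground
states of such a system"): if, for a family of symmetry planes `p` (each with a reflection-invariant
sum-of-squares crossing structure for the same symmetric `J`), the component `S^α_tot` is a linear
combination of the ice operators, then `S^α_tot ψ = 0` for EVERY ground-state vector `ψ` of `H_J`.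
[cite: LiebSchupp1999, p. 4] -/
theorem pairHeisenberg_totalSpin_mulVec_eq_zero_of_cover (hL : Even L) (hJs : ∀ x y, J x y = J y x)
    {P : Type*} [Fintype P] (jp : P → Fin d) (ap : P → ZMod L) (vp : P → κ → TorusSite d L → ℝ)
    (hJθ : ∀ p x y, J (Torus.reflectBetweenSites (jp p) (ap p) x)
      (Torus.reflectBetweenSites (jp p) (ap p) y) = J x y)
    (hC : ∀ p, ∀ s ∈ torusLeftHalf L (jp p) (ap p), ∀ s' ∈ torusLeftHalf L (jp p) (ap p),
      J s (Torus.reflectBetweenSites (jp p) (ap p) s') = ∑ k, vp p k s * vp p k s')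
    (α : Fin 3) (c : P → κ → ℂ)
    (hcover : (totalSpin n α : Op (TorusSite d L) (n + 1)) =
      ∑ p, ∑ k, c p k • lsIceOp L (jp p) (ap p) n (vp p) k α)
    {ψ : TensorIndex (TorusSite d L) (n + 1) → ℂ} (hψ : ψ ∈ (pairHeisenberg n J).groundSpace) :
    totalSpin n α *ᵥ ψ = 0 := by
  refine Matrix.mulVec_eq_zero_of_forall_groundSpace (totalSpin_isHermitian n α)
    (commute_pairHeisenberg_totalSpin n J α).eq.symm (fun φ hφ => ?_) ψ hψ
  rw [hcover, sum_mulVec, dotProduct_sum]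
  refine sum_eq_zero fun p _ => ?_
  rw [sum_mulVec, dotProduct_sum]
  refine sum_eq_zero fun k _ => ?_
  rw [smul_mulVec, dotProduct_smul, pairHeisenberg_iceRule hL hJs (hJθ p) (vp p) (hC p) k α hφ,
    smul_zero]

/-- **Corollary: total spin zero for all ground states** — if all three components of `S_tot` are
covered by ice operators then `(S_tot)² ψ = 0` for every ground-state vector `ψ` of `H_J`
([LiebSchupp1999] p. 4). [cite: LiebSchupp1999, p. 4] -/
theorem pairHeisenberg_totalSpinSq_mulVec_eq_zero_of_cover (hL : Even L) (hJs : ∀ x y, J x y = J y x)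
    {P : Type*} [Fintype P] (jp : P → Fin d) (ap : P → ZMod L) (vp : P → κ → TorusSite d L → ℝ)
    (hJθ : ∀ p x y, J (Torus.reflectBetweenSites (jp p) (ap p) x)
      (Torus.reflectBetweenSites (jp p) (ap p) y) = J x y)
    (hC : ∀ p, ∀ s ∈ torusLeftHalf L (jp p) (ap p), ∀ s' ∈ torusLeftHalf L (jp p) (ap p),
      J s (Torus.reflectBetweenSites (jp p) (ap p) s') = ∑ k, vp p k s * vp p k s')
    (c : Fin 3 → P → κ → ℂ)
    (hcover : ∀ α : Fin 3, (totalSpin n α : Op (TorusSite d L) (n + 1)) =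
      ∑ p, ∑ k, c α p k • lsIceOp L (jp p) (ap p) n (vp p) k α)
    {ψ : TensorIndex (TorusSite d L) (n + 1) → ℂ} (hψ : ψ ∈ (pairHeisenberg n J).groundSpace) :
    totalSpinSq n *ᵥ ψ = 0 := by
  rw [totalSpinSq, sum_mulVec]
  refine sum_eq_zero fun α _ => ?_
  rw [← mulVec_mulVec,
    pairHeisenberg_totalSpin_mulVec_eq_zero_of_cover hL hJs jp ap vp hJθ hC α (c α) (hcover α) hψ,
    mulVec_zero]

end Main

end KroneckerForm

end Literature.MathematicalPhysics.QuantumLattice
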